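import Summits.Parity.GeneralizedHardyLittlewood.Theses.PrimeLevelFamEdge
import Literature.NumberTheory.LFunctions.KMVSecondMainTermFloorMasses
import Literature.NumberTheory.LFunctions.KowalskiMichelPeterssonFormula
import Literature.NumberTheory.LFunctions.IwaniecSarnakFamilyWeightTwoPeterssonPB
import Literature.NumberTheory.LFunctions.KMVMollifierDiagonalMainTerm

/-!
# Route `PrimeLevelFamEdge`, crux K_B `BeyondDiagonalBeatsQuarter` (stmt-Parity-20343): HEART ISOLATION
# RE-THREADED over the in-range Petersson bound (`kowalskiMichel2000_peterssonBound`, R2-G44 repair)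

`HeartIsolation.lean` (p527867) proves, GIVEN the route item `PeterssonPrinted`
(= `KowalskiMichel2000.kowalskiMichel2000_petersson`, the Petersson–Weil display typed for ALL
`m, n ≥ 1`), that K_B is equivalent to one strict inequality on the second off-diagonal main term:
`BeyondDiagonalBeatsQuarter ↔ (FirstMomentPrinted → HEART)`. That binder is REFUTED AS TYPED (cell
record R2-G44, 2026-08-27; tree theorems `KowalskiMichel2000.not_kowalskiMichel2000_petersson` and
`Theorems.PeterssonPrinted.Negative.kowalskiMichel2000_petersson_false_allIndices`), so the three
Petersson-dependent theorems there are vacuous as typed (the Bettin-only direction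
`heart_of_beyondDiagonalBeatsQuarter` and `heart_of_upperSomewhere_X_sq` carry no Petersson binder and
stand; their short arguments are repeated inline below so that this file imports the route file only,
not another Theorems module — theses-cone lint). This file re-lands the three with primed names over
the REPAIRED fact
`KowalskiMichel2000.kowalskiMichel2000_peterssonBound` (p528813: the same display with the binder
`¬ (q ∣ m ∧ q ∣ n)`, which is all the floor ever used — indices `(1,1)` and `(q,1)`), stated over the
LITERATURE fact name rather than a route alias so that they survive route restates (director LESSON
T8). The floor input is `KMV2000.sq_firstMainTerm_le_secondMainTerm_of_lt_two_of_masses` (Literature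
`KMVSecondMainTermFloorMasses`, p529574) fed by the two harmonic-mass roots re-threaded over the repaired
fact (`CentralValueFamilyHalfEdge.abs_totalMass_sub_one_le_pb`, `abs_two_mul_evenMass_sub_totalMass_le_pb`,
Literature `IwaniecSarnakFamilyWeightTwoPeterssonPB`, p530888; indices `(1,1)`, `(q,1)`). HEART is
spelled out in the statements (no new definition):

  HEART := ∀ Δ > 1, ∀ T₁ T₂, MomentAsymptotics 1 Δ T₁ T₂ → ∃ a b, 1 ≤ a < b ≤ min Δ 2, a < 3/2,
          ∃ P admissible, ∀ Δ' ∈ (a, b): secondMomentForm Δ' P 1 + T₂ Δ' P 1 < 2·(linForm Δ' P 1)².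

The inequality itself (second mollified moment beyond the diagonal at one prime level, famE-02) is
OPEN IN PRINT and not asserted; no Theses statement is asserted; no ex-falso use of the refuted fact;
standard axioms. «The programme SEARCHES and TYPES; no claim about Landau–Siegel zeros, Theorems 1–2
of arXiv:2211.02515 or a repaired Margin232 until a kernel theorem says so.»
-/

namespace Summit.Parity.GeneralizedHardyLittlewood.Theorems.BeyondDiagonalBeatsQuarter

open Polynomial
open Literature.NumberTheory.LFunctions
open Summit.Parity.GeneralizedHardyLittlewood.Theses.PrimeLevelFamEdge

/-- **HEART ⇒ K_B** (in-range Petersson bound + Bettin). If for some admissible profile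
`second + T₂ < 2·lin²` on a sub-window `(a, b) ⊆ [1, min Δ 2]`, `a < 3/2`, then that profile beats
`¼` there: the Cauchy–Schwarz floor `lin² = (lin + T₁)² ≤ second + T₂` (`T₁ = 0` by Bettin; floor
from the harmonic masses at prime level, Petersson at `(1,1)` and `(q,1)`) makes the total second
main term positive, and then `second + T₂ < 2·lin²` is `lin²/(2(second + T₂)) > ¼`.
[cite: KowalskiMichelVanderKam2000, §2 p. 6 and §6 p. 19]
[cite: KowalskiMichel2000, §2.3 p. 310 (display after (16)) and §2.4.2 (23)]
[cite: Bettin2017, Thm. 1.1] -/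
theorem beyondDiagonalBeatsQuarter_of_heart'
    (hPet : KowalskiMichel2000.kowalskiMichel2000_peterssonBound)
    (hH : FirstMomentPrinted →
      ∀ Δ : ℝ, 1 < Δ → ∀ T₁ T₂ : ℝ → ℝ[X] → ℝ[X] → ℝ, KMV2000.MomentAsymptotics 1 Δ T₁ T₂ →
        ∃ a b : ℝ, 1 ≤ a ∧ a < b ∧ b ≤ min Δ 2 ∧ a < 3 / 2 ∧ ∃ P : ℝ[X], KMV2000.Admissible P ∧
          ∀ Δ' : ℝ, a < Δ' → Δ' < b →
            KMV2000.secondMomentForm Δ' P 1 + T₂ Δ' P 1 < 2 * KMV2000.linForm Δ' P 1 ^ 2) :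
    BeyondDiagonalBeatsQuarter := by
  intro hF Δ hΔ T₁ T₂ hMA
  obtain ⟨a, b, ha, hab, hb, ha32, P, hP, hval⟩ := hH hF Δ hΔ T₁ T₂ hMA
  refine ⟨a, b, ha, hab, hb.trans (min_le_left _ _), ha32, P, hP, fun Δ' h1' h2' ↦ ?_⟩
  have h1 : 1 < Δ' := lt_of_le_of_lt ha h1'
  have hΔ'm : Δ' < min Δ 2 := lt_of_lt_of_le h2' hb
  have hΔ'Δ : Δ' ≤ Δ := (lt_of_lt_of_le hΔ'm (min_le_left _ _)).le
  have hΔ'2 : Δ' < 2 := lt_of_lt_of_le hΔ'm (min_le_right _ _)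
  have hT₁ : T₁ Δ' P 1 = 0 := KMV2000.T₁_apply_one_eq_zero_of_bettin hF hP hMA h1 hΔ'm
  obtain ⟨Ct, Ht⟩ := CentralValueFamilyHalfEdge.abs_totalMass_sub_one_le_pb hPet
  obtain ⟨Ce, He⟩ := CentralValueFamilyHalfEdge.abs_two_mul_evenMass_sub_totalMass_le_pb hPet
  have hfloor := KMV2000.sq_firstMainTerm_le_secondMainTerm_of_lt_two_of_masses
    ⟨Ct, 3 / 2, by norm_num, fun q _ hq ↦ Ht q hq⟩ ⟨Ce, 1 / 4, by norm_num, fun q _ hq ↦ He q hq⟩ hMA hP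
    (by linarith) hΔ'2 h1 hΔ'Δ
  have hv := hval Δ' h1' h2'
  rw [hT₁, add_zero] at hfloor ⊢
  have hDpos : 0 < KMV2000.secondMomentForm Δ' P 1 + T₂ Δ' P 1 := by nlinarith
  rw [lt_div_iff₀ (by positivity)]
  linarith

/-- **HEART ISOLATION** (re-threaded). Modulo the in-range Petersson bound at prime level
(`KowalskiMichel2000.kowalskiMichel2000_peterssonBound`, p528813), the value crux K_B (rev 3,
antecedent `FirstMomentPrinted` = Bettin 2017 Thm. 1.1) is EQUIVALENT to one strict inequality on
the second off-diagonal main term: for every window and every MA-consistent `(T₁, T₂)`, SOME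
admissible profile has `secondMomentForm Δ' P 1 + T₂ Δ' P 1 < 2·(linForm Δ' P 1)²` on SOME
sub-window `(a, b) ⊆ [1, min Δ 2]` with `a < 3/2`.
[cite: KowalskiMichelVanderKam2000, §2 p. 6, Thm. 6.1 (30)–(32), §6 p. 19]
[cite: KowalskiMichel2000, §2.3 p. 310 (display after (16)) and §2.4.2 (23)]
[cite: Bettin2017, Thm. 1.1] -/
theorem beyondDiagonalBeatsQuarter_iff_heart'
    (hPet : KowalskiMichel2000.kowalskiMichel2000_peterssonBound) :
    BeyondDiagonalBeatsQuarter ↔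
      (FirstMomentPrinted →
        ∀ Δ : ℝ, 1 < Δ → ∀ T₁ T₂ : ℝ → ℝ[X] → ℝ[X] → ℝ, KMV2000.MomentAsymptotics 1 Δ T₁ T₂ →
          ∃ a b : ℝ, 1 ≤ a ∧ a < b ∧ b ≤ min Δ 2 ∧ a < 3 / 2 ∧ ∃ P : ℝ[X], KMV2000.Admissible P ∧
            ∀ Δ' : ℝ, a < Δ' → Δ' < b →
              KMV2000.secondMomentForm Δ' P 1 + T₂ Δ' P 1 < 2 * KMV2000.linForm Δ' P 1 ^ 2) := by
  refine ⟨fun hB hF Δ hΔ T₁ T₂ hMA ↦ ?_, fun hH ↦ beyondDiagonalBeatsQuarter_of_heart' hPet hH⟩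
  -- K_B ⇒ HEART (Bettin only; the argument of `heart_of_beyondDiagonalBeatsQuarter`, p527867)
  obtain ⟨a, b, ha, hab, hbΔ, ha32, P, hP, hval⟩ := hB hF Δ hΔ T₁ T₂ hMA
  refine ⟨a, min b 2, ha, lt_min hab (by linarith), ?_, ha32, P, hP, fun Δ' h1' h2' ↦ ?_⟩
  · exact le_min (le_trans (min_le_left _ _) hbΔ) (min_le_right _ _)
  have h1 : 1 < Δ' := lt_of_le_of_lt ha h1'
  have hΔ'b : Δ' < b := lt_of_lt_of_le h2' (min_le_left _ _)
  have hΔ'2 : Δ' < min Δ 2 :=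
    lt_min (lt_of_lt_of_le hΔ'b hbΔ) (lt_of_lt_of_le h2' (min_le_right _ _))
  have hT₁ : T₁ Δ' P 1 = 0 := KMV2000.T₁_apply_one_eq_zero_of_bettin hF hP hMA h1 hΔ'2
  have hv := hval Δ' h1' hΔ'b
  rw [hT₁, add_zero] at hv
  set D : ℝ := KMV2000.secondMomentForm Δ' P 1 + T₂ Δ' P 1 with hD
  have hDpos : 0 < D := by
    by_contra h
    have h' : KMV2000.linForm Δ' P 1 ^ 2 / (2 * D) ≤ 0 :=
      div_nonpos_of_nonneg_of_nonpos (sq_nonneg _) (by linarith [not_lt.1 h])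
    linarith
  rw [lt_div_iff₀ (by positivity)] at hv
  linarith

/-- **S2u ⇒ K_B on the Theorems side** (re-threaded; in-range Petersson bound displayed): whatever
proves the registered stub S2u of the line `birth` closes K_B given the repaired Petersson fact.
[cite: KowalskiMichelVanderKam2000, Thm. 6.1 (30)–(32), §6 p. 19]
[cite: KowalskiMichel2000, §2.3 p. 310 (display after (16)) and §2.4.2 (23)] -/
theorem beyondDiagonalBeatsQuarter_of_upperSomewhere_X_sq'
    (hPet : KowalskiMichel2000.kowalskiMichel2000_peterssonBound)
    (hU : ∀ Δ : ℝ, 1 < Δ → ∀ T₁ T₂ : ℝ → ℝ[X] → ℝ[X] → ℝ, KMV2000.MomentAsymptotics 1 Δ T₁ T₂ →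
      ∃ a b : ℝ, 1 ≤ a ∧ a < b ∧ b ≤ min Δ 2 ∧ a < 3 / 2 ∧ ∀ Δ' : ℝ, a < Δ' → Δ' < b →
        KMV2000.secondMomentForm Δ' (X ^ 2) 1 + T₂ Δ' (X ^ 2) 1 <
          2 * KMV2000.linForm Δ' (X ^ 2) 1 ^ 2) :
    BeyondDiagonalBeatsQuarter := by
  refine beyondDiagonalBeatsQuarter_of_heart' hPet fun _ Δ hΔ T₁ T₂ hMA ↦ ?_
  obtain ⟨a, b, ha, hab, hb, ha32, hval⟩ := hU Δ hΔ T₁ T₂ hMA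
  exact ⟨a, b, ha, hab, hb, ha32, X ^ 2, KMV2000.admissible_X_sq, hval⟩

end Summit.Parity.GeneralizedHardyLittlewood.Theorems.BeyondDiagonalBeatsQuarter
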